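import Summits.NavierStokesRegularity.NavierStokesRegularity.Theses.FilamentSkeletonRss
import HarnessLib.Audit

/-!
# Route `FilamentSkeletonRss` · crux `SelectionBoxR` (stmt-NavierStokesRegularity-19174) — line `action_gap_seam`

`SelectionBoxR` (route decl, FIXED; rank-2 crux; lineage stmt-18687 `SelectionBox`, retired
refuted-misstated 2026-08-17T18:22Z and restated with TILT + BOUNDS) reads, after its five defining
hypotheses, `(Conj1 ∧ Conj2) ∧ Conj3`:

* `Conj1 ∧ Conj2` = the **K1″ ball box** (an `N`-parameter `C⁰` box of tilted, parameter-bounded,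
  `ρ√Γ`-separated, chord–arc, `C²` unit-speed proper filaments with EXACT tangency of the frame field
  `v = u + ½y − α e₃×y` on the ball `‖X‖ ≤ Rb√(Γ log Γ)`, unique supercritical zeros
  `3/2 + δ ≤ w′(c_j) ≤ Λ`, waist `‖X_j(c_j)‖ ≤ Rw√Γ`, Hurwitz transverse block, weighted injectivity
  of the linearised normal-tangency map) — plausibly TRUE, size L–XL, pure filament analysis;
* `Conj3` = the **accretion SIGN LAW over ALL reduced families** (`∀ (C₀ M U P B)`, continuous `B`,
  exact forced rotated-Leray equation with forcing in `span D_pj`, Type-I envelope, bounded pressure,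
  WINDOWED closeness `‖U − u_skel‖ ≤ η√Γ` on `‖y‖ ≤ Rw√Γ` off the `ρ√Γ/4`-tubes ⇒ `B_pj·B_qj < 0`
  across opposite faces) — the part every previous seat isolated as the hard one (strategist b1 on
  stmt-18687: "≥ open uniqueness-in-the-large of forced Burgers-type cores"; ideator k3's card
  `Cruxes/SelectionBox/Ideas/thin-tube-action-sandwich.md`: exponent-level large-deviation sandwich).

## The line (strategist s1 on stmt-19174, 2026-08-17): an EXPLICIT exponent-level seam

Two registered stubs and the kernel-checked composition `SelectionBoxR_of`:

1. `stub_ballBoxGap` (size L–XL; finite-dimensional + filament analysis + certified numerics) — a ball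
   box as in `Conj1 ∧ Conj2` **plus an ACTION-GAP CERTIFICATE** `GapCert` stated purely on the skeleton:
   in the rescaled variables `ξ = y/√Γ` let `W̃_p = Γ^(-1/2) v_p(√Γ·)` (frame flow, `O(1)`),
   `X̃ = Γ^(-1/2) X(√Γ·)`, `P_j(s) = Γ⁻¹ ∫_c^(√Γ s) w_j` (AXIAL POTENTIAL = the Freidlin–Wentzell cost of
   moving upstream to the waist inside the tube; it is the weight `e^(−W)` of the landed 1-D budget identity
   `B ∫e^(−W)μ = −∫e^(−W)F`, strategist b1's `accretionBudget1D_proof`), tubes of radius `ρ/4`, the visible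
   region `Vis = B̄(0,Rw) ∖ tubes`, and the FW quasipotential `V(x → y)` of `W̃_p` with paths confined to
   `Vis` (`qPot`).  Export exponent of filament `j`: `e_j = inf {V(ξ → b) + Θ_j(b)}` over wall points `ξ`
   of `j` and visible `b` NOT captured by `j`, where the weight exponent `Θ_j(b) = inf_ζ [V(b → ζ) + P_j(ζ)]`
   over wall points `ζ` of `j` (committor asymptotics of the adjoint zero mode); import exponents
   `i_j` (unsigned, generous: other walls and the window edge are free sources) and `i_j^±` (other walls,
   arrival co- or counter-oriented after material transport of `sgn γ_k · t_k` along the path).  Certificate: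
   on the face `p_j = 1`: `e_j + g₀ ≤ i_j`, `e_j < ∞`; on the face `p_j = 0`: `i_j⁺ + g₀ ≤ min(e_j, i_j⁻)`,
   `i_j⁺ < ∞`.  Also pins `−3 ≤ a ≤ 0`, `0 ≤ b < 1` (refuter finding F2 on stmt-18687) and `Λρ² ≤ g₀`
   (in-tube Gaussian cost `βρ²/64` and the `η`-slack are absorbed by the margin).
2. `stub_gapTransfer` (size XL; PDE; the hard stub) — for all constants, SOME closeness tolerance `η > 0`
   and threshold `Γ₁` (chosen HERE — the quantifier move that makes the seam non-circular: `SelectionBoxR`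
   has `∃ η` up front) make every box datum with `Conj1 ∧ Conj2 ∧ GapCert` obey `Conj3` for every admissible
   reduced family: two-sided exponent-level asymptotics `log|E_j| = −Γ e_j + o(Γ)`, `log|I_j^±| = −Γ i_j^± + o(Γ)`
   of the accretion budget `B_pj ∝ E_j − I_j⁺ + I_j⁻` (Lamb form `Σ B_k D_k = curl Ω − W×Ω + ∇H`, Stokes on
   normal circles, 1-D budget weight) — UPPER bounds universal by the generalized maximum principle for
   `|curl U|` against the HJ barrier `M e^(−ΓV)` (k3's `GeneralizedMaxPrinciple`/`HJStrictSupersolution`,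
   rc-0 signatures in `Cruxes/SelectionBox/Ideas/thin-tube-action-sandwich.md`), LOWER bounds = the one-sided
   TAIL FLOOR at the walls (KNSS-type scalar max principle for the azimuthal-mean circulation; its residue is
   the one-sided shadow of the open Burgers uniqueness problem, Gallay–Maekawa Handbook Thm 4.3).

`SelectionBoxR_of : BallBoxGap → GapTransfer → SelectionBoxR` is pure logic (take `Γ₂ ⊔ Γ₁`).

## Costume / shred self-check
Neither stub gives the crux alone: `stub_ballBoxGap` has no sign law, `stub_gapTransfer` has no box
(it is a `∀`-transfer statement); neither mentions `NavierStokesRegularity`; the difficulty is split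
(L–XL / XL), not hidden.  No `Disproof.lean` exists for stmt-19174/18687; the line honours the far-field
circulation law that retired stmt-18688 (witness boxes must be TILTED — clause present) and the refuter
findings F1/F2 on stmt-18687 (F2 pinned here; F1 — the Hurwitz clause is automatic as typed — recorded
in the card for the tenure planner).
-/

set_option linter.dupNamespace false
set_option linter.unusedVariables false

noncomputable section

namespace Summit.NavierStokesRegularity.NavierStokesRegularity.Cruxes.SelectionBoxR.ActionGapSeam

open scoped BigOperators Topology Manifold Classical MeasureTheory ProbabilityTheory Matrix InnerProductSpace ComplexConjugate ContinuousMap ENNReal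
open Filter Set Function TopologicalSpace MeasureTheory
open Literature.NS
open Literature.Analysis.FluidPDE
open Summit.NavierStokesRegularity.NavierStokesRegularity.Theses.FilamentSkeletonRss

/-! ## 1. The crux, cut at its top-level conjunction (texts VERBATIM from the route decl) -/

/-- The five defining hypotheses of `SelectionBoxR` (regularised Biot–Savart field `u`, frame field `v`,
waist gradient `A`, normal-tangency residual `T`, accretion modes `D`), bundled. -/
def DefsH (N : ℕ) (Γ : ℝ) (γ : (Fin N → ℝ) → Fin N → ℝ) (α : (Fin N → ℝ) → ℝ) (X : (Fin N → ℝ) → Fin N → ℝ → EuclideanSpace ℝ (Fin 3)) (c : (Fin N → ℝ) → Fin N → ℝ) (u : (Fin N → ℝ)→(Fin N → ℝ → EuclideanSpace ℝ (Fin 3)) → EuclideanSpace ℝ (Fin 3) → EuclideanSpace ℝ (Fin 3)) (v : (Fin N → ℝ) → EuclideanSpace ℝ (Fin 3) → EuclideanSpace ℝ (Fin 3)) (A : (Fin N → ℝ) → Fin N → (EuclideanSpace ℝ (Fin 3) →L[ℝ] EuclideanSpace ℝ (Fin 3))) (T : (Fin N → ℝ)→(Fin N → ℝ → EuclideanSpace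 ℝ (Fin 3)) → Fin N → ℝ → EuclideanSpace ℝ (Fin 3)) (D : (Fin N → ℝ) → Fin N → EuclideanSpace ℝ (Fin 3) → EuclideanSpace ℝ (Fin 3)) : Prop :=
  (∀ p Z y, u p Z y = ∑ k, (Γ*γ p k/(4*Real.pi)) • ∫ σ:ℝ, ((‖y-Z k σ‖^2+1)^(3/2:ℝ))⁻¹ • cross (deriv (Z k) σ) (y-Z k σ)) ∧ (∀ p y, v p y = u p (X p) y+(1/2:ℝ) • y-α p • cross (EuclideanSpace.single 2 1) y) ∧ (∀ p j, A p j = fderiv ℝ (v p) (X p j (c p j))) ∧ (∀ p Z j τ, T p Z j τ = (u p Z (Z j τ)+(1/2:ℝ) • Z j τ-α p • cross (EuclideanSpace.single 2 1) (Z j τ))-(⟪u p Z (Z j τ)+(1/2:ℝ) • Z j τ-α p • cross (EuclideanSpace.single 2 1) (Z j τ), deriv (Z j) τ⟫_ℝ/‖deriv (Z j) τ‖^2) • deriv (Z j) τ) ∧ (∀ p j y, D p j y = (Real.exp (-(⟪y-X p j (c p j), deriv (X p j) (c p j)⟫_ℝ)^2)*((1-Real.exp (-(‖y-X p j (c p j)‖^2-⟪y-X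 p j (c p j), deriv (X p j) (c p j)⟫_ℝ^2)))/(‖y-X p j (c p j)‖^2-⟪y-X p j (c p j), deriv (X p j) (c p j)⟫_ℝ^2))) • cross (deriv (X p j) (c p j)) (y-X p j (c p j)))

/-- `Conj1 ∧ Conj2` of `SelectionBoxR`: the K1″ ball box clauses (continuity in `(p,τ)` and the per-`p`
block), VERBATIM. -/
def BoxClauses (N : ℕ) (Γ δ ρ K Λ a b cnd Rw Rb cg θ₀ : ℝ) (γ : (Fin N → ℝ) → Fin N → ℝ) (α : (Fin N → ℝ) → ℝ) (X : (Fin N → ℝ) → Fin N → ℝ → EuclideanSpace ℝ (Fin 3)) (w : (Fin N → ℝ) → Fin N → ℝ → ℝ) (c : (Fin N → ℝ) → Fin N → ℝ) (m : (Fin N → ℝ) → Fin N → EuclideanSpace ℝ (Fin 3)) (n : (Fin N → ℝ) → Fin N → EuclideanSpace ℝ (Fin 3)) (v : (Fin N → ℝ) → EuclideanSpace ℝ (Fin 3) → EuclideanSpace ℝ (Fin 3)) (A : (Fin N → ℝ) → Fin N → (EuclideanSpace ℝ (Fin 3) →L[ℝ] EuclideanSpace ℝ (Fin 3))) (T : (Fin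 N → ℝ)→(Fin N → ℝ → EuclideanSpace ℝ (Fin 3)) → Fin N → ℝ → EuclideanSpace ℝ (Fin 3)) : Prop :=
  (∀ j, ContinuousOn (fun q:(Fin N → ℝ) × ℝ => (α q.1, γ q.1 j, X q.1 j q.2, w q.1 j q.2)) ({p:Fin N → ℝ | ∀ i, p i ∈ Icc 0 1} ×ˢ univ))∧(∀ p:Fin N → ℝ, (∀ i, p i ∈ Icc 0 1) → α p ≠ 0 ∧ (∀ j, γ p j ≠ 0)∧(∀ j, ContDiff ℝ 2 (X p j) ∧ Differentiable ℝ (w p j)∧(∀ τ, ‖deriv (X p j) τ‖ = 1)∧(∀ τ, ‖iteratedDeriv 2 (X p j) τ‖*√Γ≤K) ∧ Tendsto (fun τ => ‖X p j τ‖) (cocompact ℝ) atTop)∧(∀ j k, j ≠ k → ∀ τ σ, ρ*√Γ≤‖X p j τ-X p k σ‖)∧(∀ j τ σ, ρ*√Γ≤|τ-σ| → cg*ρ*√Γ≤‖X p j τ-X p j σ‖)∧(∀ j τ, cg*|τ-c p j|≤Rw*√Γ+‖X p j τ‖)∧(∀ j τ, w p j τ = ⟪v p (X p j τ), deriv (X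 p j) τ⟫_ℝ)∧(∀ j τ, ‖X p j τ‖≤Rb*√(Γ*Real.log Γ) → v p (X p j τ) = w p j τ • deriv (X p j) τ)∧(∀ j, ‖X p j (c p j)‖≤Rw*√Γ)∧(∀ j, |⟪deriv (X p j) (c p j), EuclideanSpace.single 2 1⟫_ℝ|≤1-θ₀)∧(θ₀≤|α p| ∧ |α p|≤θ₀⁻¹ ∧ ∀ j, θ₀≤|γ p j| ∧ |γ p j|≤θ₀⁻¹)∧(∀ j, w p j (c p j) = 0 ∧ (∀ τ, w p j τ = 0 → τ = c p j) ∧ 3/2+δ≤deriv (w p j) (c p j) ∧ deriv (w p j) (c p j)≤Λ)∧(∀ j, Orthonormal ℝ ![deriv (X p j) (c p j), m p j, n p j] ∧ ⟪A p j (m p j), m p j⟫_ℝ+⟪A p j (n p j), n p j⟫_ℝ < 0 ∧ ⟪A p j (n p j), m p j⟫_ℝ * ⟪A p j (m p j), n p j⟫_ℝ < ⟪A p j (m p j), m p j⟫_ℝ * ⟪A p j (n p j), n p j⟫_ℝ)∧(∀ Y:Fin N → ℝ → EuclideanSpace ℝ (Fin 3), (∀ j, ContDiff ℝ 2 (Y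 j))→(∀ j τ, ⟪Y j τ, deriv (X p j) τ⟫_ℝ = 0) → ∑ j, ⟪Y j (c p j), cross (EuclideanSpace.single 2 1) (X p j (c p j))⟫_ℝ = 0 → (∀ j τ, ‖Y j τ‖+‖deriv (Y j) τ‖+‖iteratedDeriv 2 (Y j) τ‖≤(1+|τ-c p j|)^b) → ∀ L:ℝ, (∀ j τ, ‖deriv (fun s:ℝ => T p (fun k σ => X p k σ+s • Y k σ) j τ) 0‖≤L*(1+|τ-c p j|)^a) → ∀ j τ, ‖Y j τ‖≤cnd*L*(1+|τ-c p j|)^b))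

/-- `Conj3` of `SelectionBoxR`: the accretion sign law over all admissible reduced families, VERBATIM. -/
def SignLaw (N : ℕ) (Γ ρ η Rw : ℝ) (α : (Fin N → ℝ) → ℝ) (X : (Fin N → ℝ) → Fin N → ℝ → EuclideanSpace ℝ (Fin 3)) (c : (Fin N → ℝ) → Fin N → ℝ) (u : (Fin N → ℝ)→(Fin N → ℝ → EuclideanSpace ℝ (Fin 3)) → EuclideanSpace ℝ (Fin 3) → EuclideanSpace ℝ (Fin 3)) (D : (Fin N → ℝ) → Fin N → EuclideanSpace ℝ (Fin 3) → EuclideanSpace ℝ (Fin 3)) : Prop :=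
  ∀ (C₀ M:ℝ) (U:(Fin N → ℝ) → EuclideanSpace ℝ (Fin 3) → EuclideanSpace ℝ (Fin 3)) (P:(Fin N → ℝ) → EuclideanSpace ℝ (Fin 3) → ℝ) (B:(Fin N → ℝ) → Fin N → ℝ), (ContinuousOn B {p:Fin N → ℝ | ∀ i, p i ∈ Icc 0 1} ∧ ∀ p:Fin N → ℝ, (∀ i, p i ∈ Icc 0 1) → U p ≠ 0 ∧ ContDiff ℝ (⊤:ℕ∞) (U p) ∧ ContDiff ℝ (⊤:ℕ∞) (P p) ∧ VectorCalculus.IsDivFree (U p)∧(∀ y, α p • (cross (EuclideanSpace.single 2 1) (U p y)-fderiv ℝ (U p) y (cross (EuclideanSpace.single 2 1) y))+(1/2:ℝ) • U p y+(1/2:ℝ) • fderiv ℝ (U p) y y-(Laplacian.laplacian (U p)) y+fderiv ℝ (U p) y (U p y)+gradient (P p) y = ∑ j, B p j • D p j y)∧(∀ y, ‖U p y‖≤C₀/(1+‖y‖))∧(∀ y, |P p y|≤M)∧(∀ y, ‖y‖≤Rw*√Γ → (∀ j τ, ρ*√Γ/4≤‖y-X p j τ‖) → ‖U p y-u p (X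 p) y‖≤η*√Γ))→(∀ (j:Fin N) (p q:Fin N → ℝ), (∀ i, p i ∈ Icc 0 1)→(∀ i, q i ∈ Icc 0 1) → p j = 0 → q j = 1 → B p j*B q j < 0)

/-- Sanity: the crux IS `∃ consts, pos ∧ ∀ Γ ≥ Γ₂, ∃ data, ∀ ops, defs → BoxClauses ∧ SignLaw`
(definitional unfolding only). [folklore] -/
theorem selectionBoxR_iff :
    SelectionBoxR ↔ (∃ (N:ℕ) (δ ρ K Λ a b cnd η Rw Rb cg θ₀ Γ₂:ℝ), 0 < N ∧ 0 < δ ∧ 0 < ρ ∧ 0 < cnd ∧ 0 < η ∧ 0 < Rw ∧ 0 < Rb ∧ 0 < cg ∧ 0 < θ₀ ∧ ∀ Γ:ℝ, Γ₂≤Γ → ∃ (γ:(Fin N → ℝ) → Fin N → ℝ) (α:(Fin N → ℝ) → ℝ) (X:(Fin N → ℝ) → Fin N → ℝ → EuclideanSpace ℝ (Fin 3)) (w:(Fin N → ℝ) → Fin N → ℝ → ℝ) (c:(Fin N → ℝ) → Fin N → ℝ) (m n:(Fin N → ℝ) → Fin N → EuclideanSpace ℝ (Fin 3)), ∀ (u:(Fin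 N → ℝ)→(Fin N → ℝ → EuclideanSpace ℝ (Fin 3)) → EuclideanSpace ℝ (Fin 3) → EuclideanSpace ℝ (Fin 3)) (v:(Fin N → ℝ) → EuclideanSpace ℝ (Fin 3) → EuclideanSpace ℝ (Fin 3)) (A:(Fin N → ℝ) → Fin N → (EuclideanSpace ℝ (Fin 3) →L[ℝ] EuclideanSpace ℝ (Fin 3))) (T:(Fin N → ℝ)→(Fin N → ℝ → EuclideanSpace ℝ (Fin 3)) → Fin N → ℝ → EuclideanSpace ℝ (Fin 3)) (D:(Fin N → ℝ) → Fin N → EuclideanSpace ℝ (Fin 3) → EuclideanSpace ℝ (Fin 3)), (∀ p Z y, u p Z y = ∑ k, (Γ*γ p k/(4*Real.pi)) • ∫ σ:ℝ, ((‖y-Z k σ‖^2+1)^(3/2:ℝ))⁻¹ • cross (deriv (Z k) σ) (y-Z k σ))→(∀ p y, v p y = u p (X p) y+(1/2:ℝ) • y-α p • cross (EuclideanSpace.single 2 1) y)→(∀ p j, A p j = fderiv ℝ (v p) (X p j (c p j)))→(∀ p Z j τ, T p Z j τ = (u p Z (Z j τ)+(1/2:ℝ) • Z j τ-α p • cross (EuclideanSpace.single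 2 1) (Z j τ))-(⟪u p Z (Z j τ)+(1/2:ℝ) • Z j τ-α p • cross (EuclideanSpace.single 2 1) (Z j τ), deriv (Z j) τ⟫_ℝ/‖deriv (Z j) τ‖^2) • deriv (Z j) τ)→(∀ p j y, D p j y = (Real.exp (-(⟪y-X p j (c p j), deriv (X p j) (c p j)⟫_ℝ)^2)*((1-Real.exp (-(‖y-X p j (c p j)‖^2-⟪y-X p j (c p j), deriv (X p j) (c p j)⟫_ℝ^2)))/(‖y-X p j (c p j)‖^2-⟪y-X p j (c p j), deriv (X p j) (c p j)⟫_ℝ^2))) • cross (deriv (X p j) (c p j)) (y-X p j (c p j)))→ BoxClauses N Γ δ ρ K Λ a b cnd Rw Rb cg θ₀ γ α X w c m n v A T ∧ SignLaw N Γ ρ η Rw α X c u D) :=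
  Iff.rfl

/-! ## 2. Exponent-level bookkeeping on the skeleton (ξ = y/√Γ units; Freidlin–Wentzell) -/

/-- Rescaled filament `X̃(s) = Γ^(-1/2) X(√Γ s)` (unit speed is preserved). -/
def rsCurve (Γ : ℝ) (Y : ℝ → EuclideanSpace ℝ (Fin 3)) : ℝ → EuclideanSpace ℝ (Fin 3) := fun s => (Real.sqrt Γ)⁻¹ • Y (Real.sqrt Γ * s)

/-- Rescaled frame field `W̃(ξ) = Γ^(-1/2) v(√Γ ξ)` (an `O(1)` field: Biot–Savart of the rescaled filaments
with circulations `γ_k`, plus `½ξ − α e₃×ξ`, up to `O(Γ^(-1/2))` core regularisation). -/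
def rsField (Γ : ℝ) (V : EuclideanSpace ℝ (Fin 3) → EuclideanSpace ℝ (Fin 3)) : EuclideanSpace ℝ (Fin 3) → EuclideanSpace ℝ (Fin 3) := fun ξ => (Real.sqrt Γ)⁻¹ • V (Real.sqrt Γ • ξ)

/-- Axial potential of filament `j` in ξ-units: `P(s) = Γ⁻¹ ∫_c^(√Γ s) w = ∫_(c/√Γ)^s w̃`, `w̃(σ) = Γ^(-1/2) w(√Γ σ)`;
nonnegative for a slip with a unique increasing zero at `c`; `e^(−Γ P)` is the weight of the 1-D budget. -/
def axialPot (Γ : ℝ) (ws : ℝ → ℝ) (c₀ : ℝ) (s : ℝ) : ℝ := Γ⁻¹ * ∫ τ in c₀..(Real.sqrt Γ * s), ws τ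

/-- Freidlin–Wentzell action of a path for the drift `W` (diffusivity `1/Γ` in ξ-units ⇒ densities `≍ e^(−Γ·action)`). -/
def fwAction (W : EuclideanSpace ℝ (Fin 3) → EuclideanSpace ℝ (Fin 3)) (T : ℝ) (φ : ℝ → EuclideanSpace ℝ (Fin 3)) : ℝ := ∫ t in (0:ℝ)..T, ‖deriv φ t - W (φ t)‖ ^ 2 / 4

/-- Point-to-point quasipotential of `W` with `C¹` paths confined to `S` (value `∞` if none). -/
def qPot (W : EuclideanSpace ℝ (Fin 3) → EuclideanSpace ℝ (Fin 3)) (S : Set (EuclideanSpace ℝ (Fin 3))) (x y : EuclideanSpace ℝ (Fin 3)) : ℝ≥0∞ :=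
  sInf {r : ℝ≥0∞ | ∃ (T : ℝ) (φ : ℝ → EuclideanSpace ℝ (Fin 3)), 0 ≤ T ∧ ContDiff ℝ 1 φ ∧ φ 0 = x ∧ φ T = y ∧ (∀ t ∈ Icc 0 T, φ t ∈ S) ∧ r = ENNReal.ofReal (fwAction W T φ)}

/-- Open tube of radius `r` about a curve. -/
def tube (Y : ℝ → EuclideanSpace ℝ (Fin 3)) (r : ℝ) : Set (EuclideanSpace ℝ (Fin 3)) := {ξ | Metric.infDist ξ (range Y) < r}

/-- Visible region: the closed window ball minus the open tubes (where windowed closeness pins the family). -/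
def visible {N : ℕ} (Y : Fin N → ℝ → EuclideanSpace ℝ (Fin 3)) (r R : ℝ) : Set (EuclideanSpace ℝ (Fin 3)) := Metric.closedBall (0 : EuclideanSpace ℝ (Fin 3)) R \ ⋃ k, tube (Y k) r

/-- Wall of filament `k`: visible points at distance exactly `r` from it. -/
def wall {N : ℕ} (Y : Fin N → ℝ → EuclideanSpace ℝ (Fin 3)) (r R : ℝ) (k : Fin N) : Set (EuclideanSpace ℝ (Fin 3)) := {ξ | ξ ∈ visible Y r R ∧ Metric.infDist ξ (range (Y k)) = r}

/-- Foot cost of a wall point: the least axial potential among its feet within `2r` (value `∞` if none). -/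
def footCost (P : ℝ → ℝ) (Yk : ℝ → EuclideanSpace ℝ (Fin 3)) (r : ℝ) (ζ : EuclideanSpace ℝ (Fin 3)) : ℝ≥0∞ :=
  sInf {q : ℝ≥0∞ | ∃ s : ℝ, ‖ζ - Yk s‖ ≤ 2 * r ∧ q = ENNReal.ofReal (P s)}

/-- Weight exponent `Θ_j(b) = inf_ζ [V(b → ζ) + P_j(ζ)]` over wall points `ζ` of `j`: the large-deviation
exponent of the adjoint (committor) zero mode that defines `B_pj` — reach tube `j`, then climb to its waist. -/
def weightExp {N : ℕ} (W : EuclideanSpace ℝ (Fin 3) → EuclideanSpace ℝ (Fin 3)) (Y : Fin N → ℝ → EuclideanSpace ℝ (Fin 3)) (P : Fin N → ℝ → ℝ) (r R : ℝ) (j : Fin N) (b : EuclideanSpace ℝ (Fin 3)) : ℝ≥0∞ :=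
  sInf {q : ℝ≥0∞ | ∃ ζ : EuclideanSpace ℝ (Fin 3), ζ ∈ wall Y r R j ∧ q = qPot W (visible Y r R) b ζ + footCost (P j) (Y j) r ζ}

/-- Captured set of filament `j`: visible points that reach its wall at zero cost (forward streamlines). -/
def captured {N : ℕ} (W : EuclideanSpace ℝ (Fin 3) → EuclideanSpace ℝ (Fin 3)) (Y : Fin N → ℝ → EuclideanSpace ℝ (Fin 3)) (r R : ℝ) (j : Fin N) : Set (EuclideanSpace ℝ (Fin 3)) :=
  {b | b ∈ visible Y r R ∧ sInf {q : ℝ≥0∞ | ∃ ζ : EuclideanSpace ℝ (Fin 3), ζ ∈ wall Y r R j ∧ q = qPot W (visible Y r R) b ζ} = 0}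

/-- EXPORT exponent of filament `j`: cheapest capture-leaving excursion from its wall, weighted at re-absorption:
`e_j = inf {V(ξ → b) + Θ_j(b) : ξ ∈ wall_j, b visible and not captured by j}` (stripping beyond the cat's eye). -/
def exportExp {N : ℕ} (W : EuclideanSpace ℝ (Fin 3) → EuclideanSpace ℝ (Fin 3)) (Y : Fin N → ℝ → EuclideanSpace ℝ (Fin 3)) (P : Fin N → ℝ → ℝ) (r R : ℝ) (j : Fin N) : ℝ≥0∞ :=
  sInf {q : ℝ≥0∞ | ∃ ξ b : EuclideanSpace ℝ (Fin 3), ξ ∈ wall Y r R j ∧ b ∈ visible Y r R ∧ b ∉ captured W Y r R j ∧ q = qPot W (visible Y r R) ξ b + weightExp W Y P r R j b}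

/-- Unsigned IMPORT exponent into filament `j` (generous: every other wall and the window edge are free sources):
`i_j = inf {V(x → ζ) + P_j(ζ) : x ∈ sphere(0,R) ∪ ⋃_(k≠j) wall_k, ζ ∈ wall_j}`. -/
def importExp {N : ℕ} (W : EuclideanSpace ℝ (Fin 3) → EuclideanSpace ℝ (Fin 3)) (Y : Fin N → ℝ → EuclideanSpace ℝ (Fin 3)) (P : Fin N → ℝ → ℝ) (r R : ℝ) (j : Fin N) : ℝ≥0∞ :=
  sInf {q : ℝ≥0∞ | ∃ x ζ : EuclideanSpace ℝ (Fin 3), (x ∈ Metric.sphere (0 : EuclideanSpace ℝ (Fin 3)) R ∨ ∃ k, k ≠ j ∧ x ∈ wall Y r R k) ∧ ζ ∈ wall Y r R j ∧ q = qPot W (visible Y r R) x ζ + footCost (P j) (Y j) r ζ}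

/-- ORIENTED import exponent into filament `j` from the other walls (`ε = 1`: arrivals co-oriented with
`sgn γ_j · t_j`, `ε = −1`: counter-oriented), the source direction `sgn γ_k · t_k` being transported along the
path by the linearised frame field (material line elements): co-oriented arrivals add circulation, counter-oriented
ones cancel it. -/
def importExpOr {N : ℕ} (W : EuclideanSpace ℝ (Fin 3) → EuclideanSpace ℝ (Fin 3)) (Y : Fin N → ℝ → EuclideanSpace ℝ (Fin 3)) (sg : Fin N → ℝ) (P : Fin N → ℝ → ℝ) (r R : ℝ) (j : Fin N) (ε : ℝ) : ℝ≥0∞ :=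
  sInf {q : ℝ≥0∞ | ∃ (k : Fin N) (σ s T : ℝ) (φ ℓ : ℝ → EuclideanSpace ℝ (Fin 3)), k ≠ j ∧ 0 ≤ T ∧ ContDiff ℝ 1 φ ∧ φ 0 ∈ wall Y r R k ∧ ‖φ 0 - Y k σ‖ ≤ 2 * r ∧ φ T ∈ wall Y r R j ∧ ‖φ T - Y j s‖ ≤ 2 * r ∧ (∀ t ∈ Icc 0 T, φ t ∈ visible Y r R) ∧ ℓ 0 = sg k • deriv (Y k) σ ∧ (∀ t, HasDerivAt ℓ (fderiv ℝ W (φ t) (ℓ t)) t) ∧ 0 < ε * sg j * ⟪ℓ T, deriv (Y j) s⟫_ℝ ∧ q = ENNReal.ofReal (fwAction W T φ) + ENNReal.ofReal (P j s)}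

/-- **The action-gap certificate** of a box datum at circulation `Γ` with margin `g₀`, wall radius `ρ/4` and
window `Rw` (ξ-units): on the face `p_j = 1` filament `j` is EXPORT-dominated (`e_j + g₀ ≤ i_j`, `e_j < ∞`),
on the face `p_j = 0` it is IMPORT-dominated by co-oriented donors (`i_j⁺ + g₀ ≤ min(e_j, i_j⁻)`, `i_j⁺ < ∞`). -/
def GapCert (N : ℕ) (Γ ρ Rw g₀ : ℝ) (γ : (Fin N → ℝ) → Fin N → ℝ) (X : (Fin N → ℝ) → Fin N → ℝ → EuclideanSpace ℝ (Fin 3)) (w : (Fin N → ℝ) → Fin N → ℝ → ℝ) (c : (Fin N → ℝ) → Fin N → ℝ) (v : (Fin N → ℝ) → EuclideanSpace ℝ (Fin 3) → EuclideanSpace ℝ (Fin 3)) : Prop :=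
  ∀ p : Fin N → ℝ, (∀ i, p i ∈ Icc (0:ℝ) 1) → ∀ j : Fin N,
    (p j = 1 →
      exportExp (rsField Γ (v p)) (fun k => rsCurve Γ (X p k)) (fun k => axialPot Γ (w p k) (c p k)) (ρ/4) Rw j + ENNReal.ofReal g₀
        ≤ importExp (rsField Γ (v p)) (fun k => rsCurve Γ (X p k)) (fun k => axialPot Γ (w p k) (c p k)) (ρ/4) Rw j ∧
      exportExp (rsField Γ (v p)) (fun k => rsCurve Γ (X p k)) (fun k => axialPot Γ (w p k) (c p k)) (ρ/4) Rw j ≠ ⊤) ∧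
    (p j = 0 →
      importExpOr (rsField Γ (v p)) (fun k => rsCurve Γ (X p k)) (fun k => Real.sign (γ p k)) (fun k => axialPot Γ (w p k) (c p k)) (ρ/4) Rw j 1 + ENNReal.ofReal g₀
        ≤ min (exportExp (rsField Γ (v p)) (fun k => rsCurve Γ (X p k)) (fun k => axialPot Γ (w p k) (c p k)) (ρ/4) Rw j)
              (importExpOr (rsField Γ (v p)) (fun k => rsCurve Γ (X p k)) (fun k => Real.sign (γ p k)) (fun k => axialPot Γ (w p k) (c p k)) (ρ/4) Rw j (-1)) ∧
      importExpOr (rsField Γ (v p)) (fun k => rsCurve Γ (X p k)) (fun k => Real.sign (γ p k)) (fun k => axialPot Γ (w p k) (c p k)) (ρ/4) Rw j 1 ≠ ⊤)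

/-! ## 3. The two stubs and the composition -/

/-- Statement of stub 1: a certified ball box. -/
def BallBoxGap : Prop :=
  ∃ (N:ℕ) (δ ρ K Λ a b cnd Rw Rb cg θ₀ g₀ Γ₂:ℝ), 0 < N ∧ 0 < δ ∧ 0 < ρ ∧ 0 < cnd ∧ 0 < Rw ∧ 0 < Rb ∧ 0 < cg ∧ 0 < θ₀ ∧ 0 < g₀ ∧ Λ * ρ ^ 2 ≤ g₀ ∧ -3 ≤ a ∧ a ≤ 0 ∧ 0 ≤ b ∧ b < 1 ∧
    ∀ Γ:ℝ, Γ₂ ≤ Γ → ∃ (γ:(Fin N → ℝ) → Fin N → ℝ) (α:(Fin N → ℝ) → ℝ) (X:(Fin N → ℝ) → Fin N → ℝ → EuclideanSpace ℝ (Fin 3)) (w:(Fin N → ℝ) → Fin N → ℝ → ℝ) (c:(Fin N → ℝ) → Fin N → ℝ) (m n:(Fin N → ℝ) → Fin N → EuclideanSpace ℝ (Fin 3)), ∀ (u:(Fin N → ℝ)→(Fin N → ℝ → EuclideanSpace ℝ (Fin 3)) → EuclideanSpace ℝ (Fin 3) → EuclideanSpace ℝ (Fin 3)) (v:(Fin N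 → ℝ) → EuclideanSpace ℝ (Fin 3) → EuclideanSpace ℝ (Fin 3)) (A:(Fin N → ℝ) → Fin N → (EuclideanSpace ℝ (Fin 3) →L[ℝ] EuclideanSpace ℝ (Fin 3))) (T:(Fin N → ℝ)→(Fin N → ℝ → EuclideanSpace ℝ (Fin 3)) → Fin N → ℝ → EuclideanSpace ℝ (Fin 3)) (D:(Fin N → ℝ) → Fin N → EuclideanSpace ℝ (Fin 3) → EuclideanSpace ℝ (Fin 3)),
      DefsH N Γ γ α X c u v A T D →
        BoxClauses N Γ δ ρ K Λ a b cnd Rw Rb cg θ₀ γ α X w c m n v A T ∧ GapCert N Γ ρ Rw g₀ γ X w c v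

/-- Statement of stub 2: the exponent-level sign transfer (it chooses the closeness tolerance `η` and `Γ₁`). -/
def GapTransfer : Prop :=
  ∀ (N:ℕ) (δ ρ K Λ a b cnd Rw Rb cg θ₀ g₀:ℝ), 0 < N → 0 < δ → 0 < ρ → 0 < cnd → 0 < Rw → 0 < Rb → 0 < cg → 0 < θ₀ → 0 < g₀ → Λ * ρ ^ 2 ≤ g₀ → -3 ≤ a → a ≤ 0 → 0 ≤ b → b < 1 →
    ∃ (η Γ₁:ℝ), 0 < η ∧ ∀ Γ:ℝ, Γ₁ ≤ Γ → ∀ (γ:(Fin N → ℝ) → Fin N → ℝ) (α:(Fin N → ℝ) → ℝ) (X:(Fin N → ℝ) → Fin N → ℝ → EuclideanSpace ℝ (Fin 3)) (w:(Fin N → ℝ) → Fin N → ℝ → ℝ) (c:(Fin N → ℝ) → Fin N → ℝ) (m n:(Fin N → ℝ) → Fin N → EuclideanSpace ℝ (Fin 3)) (u:(Fin N → ℝ)→(Fin N → ℝ → EuclideanSpace ℝ (Fin 3)) → EuclideanSpace ℝ (Fin 3) → EuclideanSpace ℝ (Fin 3)) (v:(Fin N → ℝ) → EuclideanSpace ℝ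 (Fin 3) → EuclideanSpace ℝ (Fin 3)) (A:(Fin N → ℝ) → Fin N → (EuclideanSpace ℝ (Fin 3) →L[ℝ] EuclideanSpace ℝ (Fin 3))) (T:(Fin N → ℝ)→(Fin N → ℝ → EuclideanSpace ℝ (Fin 3)) → Fin N → ℝ → EuclideanSpace ℝ (Fin 3)) (D:(Fin N → ℝ) → Fin N → EuclideanSpace ℝ (Fin 3) → EuclideanSpace ℝ (Fin 3)),
      DefsH N Γ γ α X c u v A T D →
        BoxClauses N Γ δ ρ K Λ a b cnd Rw Rb cg θ₀ γ α X w c m n v A T → GapCert N Γ ρ Rw g₀ γ X w c v →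
          SignLaw N Γ ρ η Rw α X c u D

/-- **Stub 1 (`stub_ballBoxGap`, size L–XL: finite-dimensional + filament analysis + certified numerics).**
There are `N ≥ 2` filaments and Γ-free constants such that for every large `Γ` an `N`-parameter `C⁰` box of
TILTED, parameter-bounded, ball-exact skeletons with unique supercritical zeros, Hurwitz waists and weighted
non-degeneracy exists (the clauses `Conj1 ∧ Conj2` of the crux VERBATIM, exponents pinned `−3 ≤ a ≤ 0 ≤ b < 1`)
AND carries the action-gap certificate `GapCert` with margin `g₀ ≥ Λρ²`: along the `j`-th box direction filament
`j` passes from import-dominated (`p_j = 0`) to export-dominated (`p_j = 1`) at exponent level.  Why plausibly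
true: the regime-A inner analysis (refuter notes on stmt-18687: explicit `N = 2` `R_π`-symmetric skew pair
`θ = π/4, γ = 12, ρ = 1, α = 3.2349`, unique zero `σ_c = −0.577`, `w′ = 1.7405`, Hurwitz; D*: `det A⊥ = +0.277`)
gives the ball box by continuation in `(tilt, offset, α)` (LIA-dominated tangency map, diagonal `~ (Γγ/4π)log(ℓ/a)·κ`,
the three-quarter law of `Cruxes/TransverseReduction/Ideas/three-quarter-cyclonic-pairing.md` for the per-filament
injectivity clause); the dial `p_j` is filament `j`'s normal slip `|S_n(c_j)|` (capture radius `r_s = γ_j/(2π|S_n|)`,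
export action `≈ β r_s²/4`: k3's card, numbers `0.70 / 0.087 / 0.111` for pair A / D* / K1), the gaps are `O(1)`
and computable by gMAM / ordered-upwind on the explicit frame flow — the CHEAPEST FALSIFIER of the whole line
(no admissible tilted `C_N` datum with a sign-changing certified gap ⇒ line dead).  Leans on: SkeletonEquilibrium
supports p136450 p136576 p136731 p137683 p137771 p137835 p135244 p163447 p165350; `accretionBudget1D_proof`
(b1, evidence on stmt-18687); GutierrezVega2004; BanicaVega arXiv:0802.1996; Freidlin 1985 (Functional Integration
and PDE) ch. on small parameter; Heymann–Vanden-Eijnden gMAM doi:10.1002/cpa.20238. -/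
theorem stub_ballBoxGap : BallBoxGap := by
  sorry

/-- **Stub 2 (`stub_gapTransfer`, size XL — the hard stub; PDE).**  For all Γ-free constants there are a
closeness tolerance `η > 0` and `Γ₁` such that for `Γ ≥ Γ₁` EVERY box datum satisfying `Conj1 ∧ Conj2 ∧ GapCert`
satisfies the sign law `Conj3` for EVERY admissible reduced family `(C₀, M, U, P, B)`: (i) Lamb form + Stokes on
visible normal circles read `B_pj` as the `e^(−ΓP_j)`-weighted net vorticity budget of tube `j` (b1's 1-D identity);
(ii) UNIVERSAL UPPER BOUNDS `|Ω_p(√Γ ξ)| ≤ Γ^C e^(−Γ(V(sources → ξ) − σ))` on `Vis` for every admissible family by the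
generalized maximum principle for `q = |curl U_p|` (`Δq − W·∇q + (K_p − c̃)q ≥ 0` in Kato's sense, `K_p ≤ K` from
windowed closeness + interior regularity) against the strict HJ supersolution `ψ = M e^(−ΓV_skel)` (slack
`σ = βρ²/64 + Cη + O(Γ^(-1/2) log Γ)`, whence the choice of `η`); (iii) the matching LOWER bounds along the
minimising channels from a ONE-SIDED TAIL FLOOR at the walls (`ω̄_k(ρ√Γ/4) ≥ Γ^(-C) e^(−C_F Γρ²)`, KNSS-type scalar
maximum principle for the azimuthal-mean circulation — the residue; its two-sided version is next to the open
uniqueness of Burgers-type vortices, Gallay–Maekawa Handbook Thm 4.3) and co-orientation by transport;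
(iv) `g₀ > 2σ` ⇒ `sign B_pj` = export sign on `p_j = 1`, import sign on `p_j = 0`, continuously in `p` ⇒ `B_pj B_qj < 0`.
Why it might fail: (iii) for ALL admissible families (breakdown-scale / two-cell cores change prefactors — fine —
but an admissible family with an `O(ρ√Γ)`-displaced or split core inside the invisible tube could violate the floor);
budgets outside the window (`C₀` free) must be shown irrelevant (expanding drift; `Rw` is the box's).  Leans on:
`stub_accretionModeTools` (p141640), `stub_farFieldObstruction` (p139624), KNSS2009, Freidlin–Wentzell,
arXiv:1610.08384 Thm 4.3, Feng–Šverák arXiv:1310.7518 (one-sided/entropy uniqueness mechanisms). -/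
theorem stub_gapTransfer : GapTransfer := by
  sorry

/-- **Composition (pure logic).**  A certified ball box and the sign transfer give `SelectionBoxR` BY NAME:
take the box's constants, the transfer's `η` and `Γ₁`, and `Γ₂ ⊔ Γ₁`. [folklore] -/
theorem SelectionBoxR_of (h1 : BallBoxGap) (h2 : GapTransfer) :
    Summit.NavierStokesRegularity.NavierStokesRegularity.Theses.FilamentSkeletonRss.SelectionBoxR := by
  obtain ⟨N, δ, ρ, K, Λ, a, b, cnd, Rw, Rb, cg, θ₀, g₀, Γ₂, hN, hδ, hρ, hcnd, hRw, hRb, hcg, hθ, hg, hΛρ, ha1, ha2, hb1, hb2, hbox⟩ := h1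
  obtain ⟨η, Γ₁, hη, htr⟩ := h2 N δ ρ K Λ a b cnd Rw Rb cg θ₀ g₀ hN hδ hρ hcnd hRw hRb hcg hθ hg hΛρ ha1 ha2 hb1 hb2
  refine ⟨N, δ, ρ, K, Λ, a, b, cnd, η, Rw, Rb, cg, θ₀, max Γ₂ Γ₁, hN, hδ, hρ, hcnd, hη, hRw, hRb, hcg, hθ, ?_⟩
  intro Γ hΓ
  obtain ⟨γ, α, X, w, c, m, n, hdata⟩ := hbox Γ ((le_max_left _ _).trans hΓ)
  refine ⟨γ, α, X, w, c, m, n, ?_⟩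
  intro u v A T D hu hv hA hT hD
  have hd := hdata u v A T D ⟨hu, hv, hA, hT, hD⟩
  exact ⟨hd.1, htr Γ ((le_max_right _ _).trans hΓ) γ α X w c m n u v A T D ⟨hu, hv, hA, hT, hD⟩ hd.1 hd.2⟩

/-- The crux from the registered stubs. -/
theorem selectionBoxR_from_line :
    Summit.NavierStokesRegularity.NavierStokesRegularity.Theses.FilamentSkeletonRss.SelectionBoxR :=
  SelectionBoxR_of stub_ballBoxGap stub_gapTransfer

end Summit.NavierStokesRegularity.NavierStokesRegularity.Cruxes.SelectionBoxR.ActionGapSeam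

end
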